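import Mathlib
import Summits.Ventures.HodgeRepro.Tier4.Common.AdelicDefs
import Summits.Ventures.HodgeRepro.Tier4.Line1.NormOneTorus
import Summits.Ventures.HodgeRepro.Tier4.Line1.CornerCharacters

/-!
# Tier4/Line1/U1CharAlgebra — LINE L1, (I0-R) follow-up: the algebra of `U(1)`-characters and the satisfiability of N2
by the choice of the fourth corner character

Blind re-derivation cell `pub-hodge-repro`, Tier 4 «prove the step» (README §9–§10), seat t4-L1-p2 (gen 3), LINE L1,
follow-up of the cut (I0-R) (CornerCharacters p680314: `IsU1Char d ν` = a continuous unitary character of `E′¹(𝔸)`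
trivial on `E′¹(k)`, in p5's pair model of `𝔸_k[√−d]`).  Target tree path
`lean/Summits/Ventures/HodgeRepro/Tier4/Line1/U1CharAlgebra.lean`.

WHAT IS PROVED (Mathlib + the named modules only, no printed input).
* `IsU1Char.one`: the trivial character is a `U(1)`-character; `IsU1Char.map_qone`: a `U(1)`-character takes the value
  `1` at the unit `(1, 0)`; `IsU1Char.mul'`: the pointwise product of two `U(1)`-characters is one;
  `IsU1Char.conjChar'`: the conjugate character `conjChar ν := ν ∘ qconj` (= `ν⁻¹` on `E′¹(𝔸)`, `mul_conjChar`) is one.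
* `exists_u1Char_N2 (h₀ h₁ h₂) : ∃ ν₃, IsU1Char d ν₃ ∧ ∀ s, N s = 1 → ν₀ s · ν₁ s = ν₂ s · ν₃ s` — **N2 is SATISFIABLE by
  the choice of the fourth character** (`ν₃ := ν₀ ν₁ ν̄₂`): under the ∃-form of the target (the prover's choice of the
  quadruple, lead S13093) the displayed equation `ν₀ ν₁ = ν₂ ν₃` on `E′¹(𝔸)` of `exists_rtfData_of_u1Characters` is
  met for every three `U(1)`-characters; under the ∀-form it is the scope clause of the costume (N2 is forced by a
  non-zero isolated orbital term, p4's CentralVanishing) and stays displayed.  Nothing is claimed about which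
  characters are the CORNER characters of a datum.

Nothing here says anything about the status of the Hodge conjecture for CM abelian varieties, which is NOT proved
(HC_CM is NOT proved by anyone in this repository).
-/

set_option autoImplicit false

noncomputable section

namespace Summit.Ventures.HodgeRepro.Tier4.Line1

open NumberField Summit.Ventures.HodgeRepro.Tier4.Common

variable {k : Type} [Field k] [NumberField k] {d : k}

namespace IsU1Char

/-- the trivial character is a `U(1)`-character -/
theorem one : IsU1Char d (fun _ : Fin 2 → Ad k => (1 : ℂ)) where
  mul := fun _ _ _ _ => by simp
  rational := fun _ _ => rfl
  continuousOn := continuousOn_const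
  unitary := fun _ _ => by simp

/-- a `U(1)`-character takes the value `1` at the unit `(1, 0)` of `𝔸_k[√−d]` -/
theorem map_qone {ν : (Fin 2 → Ad k) → ℂ} (h : IsU1Char d ν) : ν qone = 1 := by
  have h1 : qnorm (algebraMap k (Ad k) d) (qone : Fin 2 → Ad k) = 1 := qnorm_qone _
  have hmul := h.mul qone qone h1 h1
  rw [qmul_qone] at hmul
  have hne : ν qone ≠ 0 := by
    intro h0
    have := h.unitary qone h1
    rw [h0, norm_zero] at this
    exact zero_ne_one this
  -- `ν 1 = ν 1 · ν 1` with `ν 1 ≠ 0`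
  exact mul_left_cancel₀ hne (hmul.symm.trans (mul_one _).symm)

/-- the pointwise product of two `U(1)`-characters is a `U(1)`-character -/
theorem mul' {ν ν' : (Fin 2 → Ad k) → ℂ} (h : IsU1Char d ν) (h' : IsU1Char d ν') :
    IsU1Char d (fun z => ν z * ν' z) where
  mul := fun z w hz hw => by
    simp only [h.mul z w hz hw, h'.mul z w hz hw]
    ring
  rational := fun x hx => by simp only [h.rational x hx, h'.rational x hx, mul_one]
  continuousOn := h.continuousOn.mul h'.continuousOn
  unitary := fun z hz => by simp only [norm_mul, h.unitary z hz, h'.unitary z hz, mul_one]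

/-- the conjugate character `ν̄ := ν ∘ qconj` (the inverse of `ν` on `E′¹(𝔸)`) -/
def conjChar (ν : (Fin 2 → Ad k) → ℂ) : (Fin 2 → Ad k) → ℂ := fun z => ν (qconj z)

/-- the conjugate of a `U(1)`-character is a `U(1)`-character -/
theorem conjChar' {ν : (Fin 2 → Ad k) → ℂ} (h : IsU1Char d ν) : IsU1Char d (conjChar ν) where
  mul := fun z w hz hw => by
    have hz' : qnorm (algebraMap k (Ad k) d) (qconj z) = 1 := by rw [qnorm_qconj]; exact hz
    have hw' : qnorm (algebraMap k (Ad k) d) (qconj w) = 1 := by rw [qnorm_qconj]; exact hw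
    simp only [conjChar, qconj_qmul, h.mul _ _ hz' hw']
  rational := fun x hx => by
    have hx' : qnorm d (qconj x) = 1 := by rw [qnorm_qconj]; exact hx
    simp only [conjChar, ← qrat_qconj, h.rational _ hx']
  continuousOn := by
    refine h.continuousOn.comp continuous_qconj.continuousOn ?_
    intro z hz
    show qnorm (algebraMap k (Ad k) d) (qconj z) = 1
    rw [qnorm_qconj]
    exact hz
  unitary := fun z hz => by
    have hz' : qnorm (algebraMap k (Ad k) d) (qconj z) = 1 := by rw [qnorm_qconj]; exact hz
    exact h.unitary _ hz'

/-- `ν · ν̄ = 1` on `E′¹(𝔸)` -/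
theorem mul_conjChar {ν : (Fin 2 → Ad k) → ℂ} (h : IsU1Char d ν) {z : Fin 2 → Ad k}
    (hz : qnorm (algebraMap k (Ad k) d) z = 1) : ν z * conjChar ν z = 1 := by
  have hz' : qnorm (algebraMap k (Ad k) d) (qconj z) = 1 := by rw [qnorm_qconj]; exact hz
  rw [conjChar, ← h.mul z (qconj z) hz hz', qmul_qconj_self_of_qnorm_eq_one _ hz, h.map_qone]

end IsU1Char

/-- **N2 is satisfiable by the choice of the fourth character**: for three `U(1)`-characters `ν₀ ν₁ ν₂` there is a
`U(1)`-character `ν₃` (namely `ν₀ ν₁ ν̄₂`) with `ν₀ ν₁ = ν₂ ν₃` on `E′¹(𝔸)` — the displayed N2 equation of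
`exists_rtfData_of_u1Characters` under the ∃-form of the target (the prover's choice of the quadruple). -/
theorem exists_u1Char_N2 {ν₀ ν₁ ν₂ : (Fin 2 → Ad k) → ℂ} (h₀ : IsU1Char d ν₀) (h₁ : IsU1Char d ν₁)
    (h₂ : IsU1Char d ν₂) :
    ∃ ν₃ : (Fin 2 → Ad k) → ℂ, IsU1Char d ν₃ ∧
      ∀ s : Fin 2 → Ad k, qnorm (algebraMap k (Ad k) d) s = 1 → ν₀ s * ν₁ s = ν₂ s * ν₃ s := by
  refine ⟨fun z => ν₀ z * ν₁ z * IsU1Char.conjChar ν₂ z, (h₀.mul' h₁).mul' h₂.conjChar', fun s hs => ?_⟩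
  have := h₂.mul_conjChar hs
  calc ν₀ s * ν₁ s = ν₀ s * ν₁ s * (ν₂ s * IsU1Char.conjChar ν₂ s) := by rw [this, mul_one]
    _ = ν₂ s * (ν₀ s * ν₁ s * IsU1Char.conjChar ν₂ s) := by ring

end Summit.Ventures.HodgeRepro.Tier4.Line1

end
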